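import Literature.NumberTheory.DiophantineGeometry.AbcWave0GranvilleStarkProofs
import Literature.NumberTheory.EllipticCurves.ComplexMultiplicationHasCMTwoLeavesProofs
import Literature.NumberTheory.EllipticCurves.ComplexMultiplicationClassPolynomialIrreducibleProofs
import Literature.NumberTheory.EllipticCurves.KleinJCuspExpansion
import Literature.NumberTheory.EllipticCurves.LatticeJInvariant
import HarnessLib

/-!
# Granville–Stark, *ABC implies no "Siegel zeros"* (Invent. Math. 139 (2000)): the height
# argument of §2 — Theorem 1 from uniform abc and the data of Lemma 1, proved

Topic `Literature/NumberTheory/DiophantineGeometry`; a proofs-only sibling (theorems only, no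
definitions, no named facts) of `AbcWave0.lean` and of `AbcWave0GranvilleStarkProofs.lean` (which
proves the deduction "Theorem 1 + eq. (11) ⟹ Theorem 2",
`granville_stark_noSiegelZeros_of_thm1_of_eq11`), whose named fact
`Literature.NumberTheory.DiophantineGeometry.granville_stark_noSiegelZeros`
(`UniformABCConjecture → NoSiegelZerosOddQuadratic`, [GranvilleStark2000, Theorem 2]) is the
target.  The printed proof ([GranvilleStark2000, §2 and §1]) runs: uniform abc in
`K = ℚ(√−d)(γ₂(τ), γ₃(τ))` (Lemma 1: `Δ_K ≤ 6√d`, by Shimura reciprocity and the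
conductor–discriminant formula) applied to `γ₃² − γ₂³ + 1728 = 0` bounds the height of the
singular modulus `j(τ)`, `H(j(τ),1) ≪_ε d^{3+ε}` (eq. (6)); the `q`-expansion gives
`H(j(τ),1) ≍ exp(h(−d)⁻¹ ∑ π√d/a)` over the reduced forms `(a,b,c)` of discriminant `−d`
(eq. (7)); whence Theorem 1, `h(−d) ≥ (π/3 + o(1))(√d/log d) ∑ 1/a`, and Theorem 2 by Mahler's
theorem.  The class-field-theoretic input of Lemma 1 is in neither Mathlib nor the tree, so the
discharge is not in reach; this file proves the complete height argument of §2 CONDITIONALLY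
on the data of Lemma 1, and the `q`-expansion lower bound it needs:

* `pi_mul_sqrt_mul_sum_inv_le_of_uniformABC` — **Theorem 1 from uniform abc and the data of
  Lemma 1** (section `HeightArgument`): for `0 < ε < 1/5` there is `C₀` with
  `π√|D| ∑_{Q reduced} 1/a_Q ≤ h(D) ((3(1+ε)/(1−5ε)) log|D| + C₀)` for every `D < 0`,
  `D ≡ 0, 1 (mod 4)`, whenever some number field `K ∋ g₂, g₃` (algebraic integers) with a
  complex embedding `ι`, `ι(g₂)³ = j(τ_D) = ι(g₃)² + 1728`, has `|D_K| ≤ (36|D|)^{[K:ℚ]/2}`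
  (i.e. `Δ_K ≤ 6√|D|`, the conclusion of Lemma 1). Ingredients, all proved here: the conductor
  bound `N_K(1728, γ₃², γ₂³) ≤ 6ⁿ|N γ₂||N γ₃|` (`radicalNorm_le_of_sq_of_cube`), the norm/height
  comparisons `|N γ₂|³ ≤ ∏ max(1,|j|_w)^{mult}`, `|N γ₃|² ≤ 1729ⁿ ∏ max(1,|j|_w)^{mult}`,
  `∏ max(1,|j|_w)^{mult} ≤ 1728ⁿ H_K(1728 : j−1728 : j)`, the conjugates of `j(τ_D)`
  (`classNumber_mul_sum_embeddings_eq`, from the tree's theorem that the class polynomial is the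
  minimal polynomial, `minpoly_formJ_map_eq_classPolynomial`), and the lower bound below;

* `granville_stark_thm1_of_lemma1Data` — hence **the statement of Theorem 1** in the exact
  shape of the hypothesis `thm1` of `granville_stark_noSiegelZeros_of_thm1_of_eq11`
  (`(π/3 − δ)(√d/log d) ∑ 1/a ≤ h(−d)` for `d ≥ d₀(δ)` carrying an odd real primitive character),
  from uniform abc and the data of Lemma 1 for every such `d`; and the join
  `granville_stark_noSiegelZeros_of_lemma1Data_of_eq11` — **abc.S22 from the data of Lemma 1 and
  eq. (11)**: `granville_stark_noSiegelZeros` follows from (i) for every `d` carrying an odd real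
  primitive character, a number field `K ∋ γ₂, γ₃` as above with `|D_K| ≤ (36 d)^{[K:ℚ]/2}`
  [GranvilleStark2000, Lemma 1 with §2 ¶1] and (ii) the Selberg–Chowla consequence (11)
  [GranvilleStark2000, §3.2 eq. (11)] — both displayed statements of the source, neither a
  restatement of the conclusion; what the tree then lacks for `granville_stark_noSiegelZeros_holds`
  is exactly a proof of (i) (complex multiplication / class field theory) and of (ii) (Kronecker's
  limit formula over the form classes and Dirichlet's class number formula);
* `pi_mul_sqrt_div_sub_le_log_norm_formJ` — **the lower bound for singular moduli in eq. (7)**: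
  for every positive definite form `Q = (a, b, c)` of discriminant `D < 0`,
  `π√|D|/a − 10 ≤ log max(1, |j(τ_Q)|)`, from the tree's explicit cusp estimate
  `‖E₄³/Δ − 1/q − 744‖ ≤ 4·10⁵‖q‖` (`‖q‖ ≤ 10⁻⁴`; for `‖q‖ > 10⁻⁴` the bound is trivial), with
  `|q| = e^{−π√|D|/a}` at `τ_Q = (−b + √D)/(2a)` ([GranvilleStark2000, §2, proof of Theorem 1,
  "max{|j(τ*)|, 1} ≍ e^{π√d/a}"]).

## References

* A. Granville, H. M. Stark, *ABC implies no "Siegel zeros" for L-functions of characters with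
  negative discriminant*, Invent. Math. 139 (2000), 509–523: §1 (Theorems 1–2), §2 (Lemma 1,
  proof of Theorem 1, eqs. (5)–(7)). [GranvilleStark2000] (read on the authors' preprint, same
  numbering.)

## What remains for `granville_stark_noSiegelZeros_holds`

(i) Lemma 1 itself — the existence of `K ∋ γ₂(τ), γ₃(τ)` with `Δ_K ≤ 6√d` (Weber functions of
level `6`, Shimura reciprocity, ray class field mod `6`, conductor–discriminant formula) — and
the integrality of `j(τ_D)` [Cox, Thm. 11.1]; (ii) the passage from Theorem 1 (with its factor
`∑ 1/a`) to "no Siegel zeros" for large `|D|` (Mahler; or the tree's exceptional-zero inequality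
`Literature.NumberTheory.LFunctions.RealChar.re_LFunction_one_le_of_zero` together with
Dirichlet's class number formula, the representation numbers of binary quadratic forms and the
identification of odd real primitive characters with Kronecker symbols), after which the tree's
`noSiegelZerosOddQuadratic_iff_eventually` (`AbcWave0SiegelZerosProofs.lean`: large moduli and
`σ < 1` suffice) gives `NoSiegelZerosOddQuadratic`.

## Tree / Mathlib search

Uses Mathlib `Function.Periodic.norm_qParam`, `Height.mulHeight`,
`NumberField.mulHeight_eq`, `Height.mulHeight_smul_eq_mulHeight`, `InfinitePlace.prod_eq_abs_norm`,
`InfinitePlace.card_filter_mk_eq`, `algHomEquivSigma`, `AlgHom.card`,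
`IntermediateField.algHomAdjoinIntegralEquiv`, `Ideal.finite_factors`, `Ideal.absNorm_span_singleton`,
`Finset.prod_dvd_of_coprime`; tree `Literature.NumberTheory.EllipticCurves.formJ`, `heegnerTau`,
`im_heegnerTau`, `PeriodPair.j_ofUpperHalfPlane`, `minpoly_formJ_map_eq_classPolynomial`,
`natDegree_classPolynomial`, `principalForm_mem_reducedForms`, `mem_reducedForms_iff`,
`Literature.NumberTheory.EllipticCurves.ModularForms.norm_E₄_cube_div_discriminant_sub_sub_le`,
and `UniformABCConjecture`, `radicalNorm`, `badPrimes` of `AbcWave0`.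
Nothing is restated; no definition or named fact is introduced.
-/

noncomputable section

namespace Literature.NumberTheory.DiophantineGeometry

/-! ### The size of a singular modulus: `log max(1, |j(τ_Q)|) ≥ π√|D|/a − 10` -/

open _root_.Literature.NumberTheory.EllipticCurves
  _root_.Literature.NumberTheory.QuadraticFields.BinaryQuadraticForm in
/-- **Lower bound for singular moduli** ([GranvilleStark2000, §2, proof of Theorem 1]: "Since
`|1/q| = e^{π√d/a}`, we deduce from the `q`-expansion for `j(τ*)` … that
`max{|j(τ*)|, 1} ≍ e^{π√d/a}`"; here the lower half, with an explicit constant). For a positive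
definite form `Q = (a, b, c)`, `a > 0`, of discriminant `D = b² − 4ac < 0` and its CM point
`τ_Q = (−b + √D)/(2a)` one has `π√|D|/a − 10 ≤ log max(1, |j(τ_Q)|)`. Proof: `|q| = e^{−π√|D|/a}`;
if `|q| ≤ 10⁻⁴` then `|j(τ_Q) − 1/q − 744| ≤ 4·10⁵|q| ≤ 40` (the tree's cusp estimate
`norm_E₄_cube_div_discriminant_sub_sub_le`), so `|j(τ_Q)| ≥ |1/q| − 784 ≥ 0.9216|1/q|`; if
`|q| > 10⁻⁴` then `π√|D|/a < log 10⁴ < 10` and the bound is trivial.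
[cite: GranvilleStark2000, §2 (proof of Theorem 1, eq. (7))] -/
theorem pi_mul_sqrt_div_sub_le_log_norm_formJ {Q : ℤ × ℤ × ℤ} (hQ : 0 < Q.1)
    (hdisc : discr Q < 0) :
    Real.pi * √(-(discr Q : ℝ)) / Q.1 - 10 ≤ Real.log (max 1 ‖formJ Q‖) := by
  set τ := heegnerTau Q with hτdef
  set q := Function.Periodic.qParam 1 (τ : ℂ) with hqdef
  set L := Real.pi * √(-(discr Q : ℝ)) / Q.1 with hLdef
  have hA : (0 : ℝ) < Q.1 := by exact_mod_cast hQ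
  -- `|q| = e^{-L}`
  have him : (τ : ℂ).im = √(-(discr Q : ℝ)) / (2 * Q.1) := by
    rw [UpperHalfPlane.coe_im, hτdef, im_heegnerTau hQ hdisc]
    congr 2
    rw [show discr Q = Q.2.1 ^ 2 - 4 * Q.1 * Q.2.2 from rfl]
    push_cast
    ring
  have hnorm : ‖q‖ = Real.exp (-L) := by
    rw [hqdef, Function.Periodic.norm_qParam, him, hLdef]
    congr 1
    field_simp
  have hmax1 : (1 : ℝ) ≤ max 1 ‖formJ Q‖ := le_max_left _ _
  have hlogmax : 0 ≤ Real.log (max 1 ‖formJ Q‖) := Real.log_nonneg hmax1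
  -- `e^{10} ≥ 22000`
  have he10 : (22000 : ℝ) ≤ Real.exp 10 := by
    have h := Real.exp_one_gt_d9
    have h10 : Real.exp 10 = Real.exp 1 ^ 10 := by
      rw [← Real.exp_nat_mul]; norm_num
    rw [h10]
    have h27 : (2.7182818283 : ℝ) ^ 10 ≤ Real.exp 1 ^ 10 := by gcongr
    have h22 : (22000 : ℝ) ≤ (2.7182818283 : ℝ) ^ 10 := by norm_num
    linarith
  by_cases hsmall : ‖q‖ ≤ 1 / 10 ^ 4
  · -- the cusp estimate applies
    have hj : formJ Q = ModularForm.E₄ τ ^ 3 / ModularForm.discriminant τ := by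
      rw [formJ_def, PeriodPair.j_ofUpperHalfPlane]
    have hest := ModularForms.norm_E₄_cube_div_discriminant_sub_sub_le τ hsmall
    rw [← hqdef, ← hj] at hest
    have hqinv : ‖q⁻¹‖ = Real.exp L := by
      rw [norm_inv, hnorm, Real.exp_neg, inv_inv]
    -- `e^L ≥ 10⁴`
    have hbig : (10 : ℝ) ^ 4 ≤ Real.exp L := by
      have h1 : Real.exp (-L) ≤ 1 / 10 ^ 4 := hnorm ▸ hsmall
      rw [Real.exp_neg] at h1
      have h2 : 0 < Real.exp L := Real.exp_pos L
      rw [inv_le_comm₀ h2 (by norm_num), one_div, inv_inv] at h1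
      exact h1
    -- `|j| ≥ e^L - 784`
    have hlow : Real.exp L - 784 ≤ ‖formJ Q‖ := by
      have htri : ‖q⁻¹‖ ≤ ‖formJ Q‖ + ‖formJ Q - q⁻¹ - 744‖ + ‖(744 : ℂ)‖ := by
        calc ‖q⁻¹‖ = ‖formJ Q - (formJ Q - q⁻¹ - 744) - 744‖ := by ring_nf
          _ ≤ ‖formJ Q - (formJ Q - q⁻¹ - 744)‖ + ‖(744 : ℂ)‖ := norm_sub_le _ _
          _ ≤ ‖formJ Q‖ + ‖formJ Q - q⁻¹ - 744‖ + ‖(744 : ℂ)‖ := by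
              gcongr; exact norm_sub_le _ _
      have h744 : ‖(744 : ℂ)‖ = 744 := by norm_num
      have h40 : 400000 * ‖q‖ ≤ 40 := by
        calc 400000 * ‖q‖ ≤ 400000 * (1 / 10 ^ 4) := by gcongr
          _ = 40 := by norm_num
      linarith
    have hpos : 0 < Real.exp L - 784 := by linarith
    have hjpos : 0 < ‖formJ Q‖ := lt_of_lt_of_le hpos hlow
    -- `log |j| ≥ L - 10`
    have hstep : Real.exp (L - 10) ≤ Real.exp L - 784 := by
      rw [Real.exp_sub, div_le_iff₀ (Real.exp_pos 10)]
      nlinarith [Real.exp_pos L]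
    calc L - 10 = Real.log (Real.exp (L - 10)) := (Real.log_exp _).symm
      _ ≤ Real.log ‖formJ Q‖ := Real.log_le_log (Real.exp_pos _) (hstep.trans hlow)
      _ ≤ Real.log (max 1 ‖formJ Q‖) := Real.log_le_log hjpos (le_max_right _ _)
  · -- `|q| > 10⁻⁴`: the bound is trivial
    push Not at hsmall
    have hL : L < 10 := by
      by_contra hL
      push Not at hL
      have h1 : Real.exp (-L) ≤ Real.exp (-10) := Real.exp_le_exp.2 (by linarith)
      have h2 : Real.exp (-10) ≤ 1 / 10 ^ 4 := by
        rw [Real.exp_neg, one_div, inv_le_inv₀ (Real.exp_pos _) (by norm_num)]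
        linarith
      rw [← hnorm] at h1
      linarith
    linarith


/-! ## Granville–Stark Theorem 1 from the data of Lemma 1: the height argument of §2 -/

section HeightArgument

open scoped IntermediateField
open Polynomial NumberField IsDedekindDomain


open NumberField

/-! ### Infinite places versus complex embeddings -/

/-- `∏_w g(|x|_w)^{mult w} = ∏_φ g(|φ x|)`: a product over the infinite places with multiplicities
is the product over the complex embeddings (as in Mathlib's `InfinitePlace.prod_eq_abs_norm`).
[folklore] -/
theorem prod_infinitePlace_pow_mult_eq_prod_embeddings {K : Type*} [Field K] [NumberField K]
    {M : Type*} [CommMonoid M] (g : ℝ → M) (x : K) :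
    ∏ w : InfinitePlace K, g (w x) ^ w.mult = ∏ φ : K →+* ℂ, g ‖φ x‖ := by
  classical
  rw [← Finset.prod_fiberwise Finset.univ InfinitePlace.mk (fun φ : K →+* ℂ => g ‖φ x‖)]
  refine Finset.prod_congr rfl fun w _ => ?_
  have h : ∀ φ ∈ ({φ | InfinitePlace.mk φ = w} : Finset (K →+* ℂ)), g ‖φ x‖ = g (w x) := by
    intro φ hφ
    rw [← (Finset.mem_filter.mp hφ).2, InfinitePlace.apply]
  rw [Finset.prod_congr rfl h, Finset.prod_const, InfinitePlace.card_filter_mk_eq]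

/-! ### Sums over complex embeddings versus roots of the minimal polynomial -/

/-- For `x` in a number field `K` and any `f`, `∑_{φ : K → ℂ} f(φ x) = [K : ℚ(x)] · ∑ f(y)` over
the complex roots `y` of the minimal polynomial of `x` (the multiset `aroots`; the fibres of
`φ ↦ φ x` over `ℚ(x) → ℂ` have `[K : ℚ(x)]` elements, as in Mathlib's
`Algebra.sum_embeddings_eq_finrank_mul`). [folklore] -/
theorem sum_embeddings_apply_eq {K : Type*} [Field K] [NumberField K] {M : Type*}
    [AddCommMonoid M] (x : K) (f : ℂ → M) :
    ∑ φ : K →+* ℂ, f (φ x) =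
      Module.finrank ℚ⟮x⟯ K • (((minpoly ℚ x).aroots ℂ).map f).sum := by
  classical
  have hx : IsIntegral ℚ x := Algebra.IsSeparable.isIntegral ℚ x
  haveI : FiniteDimensional ℚ⟮x⟯ K := FiniteDimensional.right ℚ ℚ⟮x⟯ K
  -- pass to `ℚ`-algebra homomorphisms
  rw [Fintype.sum_equiv RingHom.equivRatAlgHom (fun φ : K →+* ℂ => f (φ x))
      (fun φ : K →ₐ[ℚ] ℂ => f (φ x)) fun _ => rfl]
  -- Step 1: group the embeddings of `K` by their restriction to `ℚ(x)`
  have step1 : ∑ σ : K →ₐ[ℚ] ℂ, f (σ x) =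
      Module.finrank ℚ⟮x⟯ K •
        ∑ τ : ℚ⟮x⟯ →ₐ[ℚ] ℂ, f (τ (IntermediateField.AdjoinSimple.gen ℚ x)) := by
    rw [Fintype.sum_equiv algHomEquivSigma (fun σ : K →ₐ[ℚ] ℂ => f (σ x))
        (fun σ => f (σ.1 (IntermediateField.AdjoinSimple.gen ℚ x))) ?_,
      ← Finset.univ_sigma_univ, Finset.sum_sigma, ← Finset.sum_nsmul]
    · refine Finset.sum_congr rfl fun σ _ => ?_
      letI : Algebra ℚ⟮x⟯ ℂ := σ.toRingHom.toAlgebra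
      simp_rw [Finset.sum_const, Finset.card_univ, ← AlgHom.card ℚ⟮x⟯ K ℂ]
    · intro σ
      simp only [algHomEquivSigma, Equiv.coe_fn_mk, AlgHom.restrictDomain, AlgHom.comp_apply,
        IsScalarTower.coe_toAlgHom', IntermediateField.AdjoinSimple.algebraMap_gen]
  -- Step 2: the embeddings of `ℚ(x)` correspond to the roots of the minimal polynomial
  have step2 : ∑ τ : ℚ⟮x⟯ →ₐ[ℚ] ℂ, f (τ (IntermediateField.AdjoinSimple.gen ℚ x)) =
      (((minpoly ℚ x).aroots ℂ).map f).sum := by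
    refine (Fintype.sum_equiv (IntermediateField.algHomAdjoinIntegralEquiv ℚ hx) _
        (fun y => f y.1) (fun τ => ?_)).trans ?_
    · simp only [IntermediateField.algHomAdjoinIntegralEquiv, Equiv.trans_apply,
        Equiv.subtypeEquiv_apply, PowerBasis.liftEquiv'_apply_coe, Equiv.refl_apply]
      rfl
    · rw [Finset.sum_mem_multiset _ (fun y => f y.1) f (fun _ => rfl), Finset.sum_eq_multiset_sum,
        Multiset.toFinset_val, Multiset.dedup_eq_self.mpr]
      exact nodup_roots ((separable_map _).mpr (Algebra.IsSeparable.isSeparable ℚ x))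
  rw [step1, step2]

open _root_.Literature.NumberTheory.EllipticCurves
  _root_.Literature.NumberTheory.QuadraticFields.BinaryQuadraticForm

/-- The complex roots of the minimal polynomial of an element `j` of a number field mapping to the
singular modulus `j(τ_P)` of the principal form are the `j(τ_Q)`, `Q` reduced (the tree's
`minpoly_formJ_map_eq_classPolynomial`: the class polynomial is the minimal polynomial).
[cite: Cox2013, §13.A Prop. 13.2] -/
theorem aroots_minpoly_eq_of_eq_formJ {K : Type*} [Field K] [NumberField K] (ι : K →+* ℂ)
    {D : ℤ} (hD : D < 0) (h4 : D % 4 = 0 ∨ D % 4 = 1) {j : K}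
    (hj : ι j = formJ (principalForm D)) :
    (minpoly ℚ j).aroots ℂ = (reducedForms D).val.map formJ := by
  have hP : principalForm D ∈ reducedForms D := principalForm_mem_reducedForms hD h4
  have hmin : minpoly ℚ j = minpoly ℚ (formJ (principalForm D)) := by
    rw [← hj]
    exact (minpoly.algHom_eq (ι.toRatAlgHom) ι.injective j).symm
  rw [aroots_def, hmin, minpoly_formJ_map_eq_classPolynomial hD hP, classPolynomial]
  have : (∏ Q ∈ reducedForms D, (X - C (formJ Q))) =
      (((reducedForms D).val.map formJ).map fun y => X - C y).prod := by
    rw [Finset.prod_eq_multiset_prod, Multiset.map_map]; rfl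
  rw [this, roots_multiset_prod_X_sub_C]

/-- **The conjugates of a singular modulus** ([GranvilleStark2000, §2 ¶1]: "whose conjugates are
the numbers `j(τ*)`"): for `j ∈ K` mapping to `j(τ_P)` under `ι : K → ℂ` and any `f`,
`h(D) · ∑_{φ : K → ℂ} f(φ j) = [K : ℚ] · ∑_{Q reduced} f(j(τ_Q))`. [cite: GranvilleStark2000, §2] -/
theorem classNumber_mul_sum_embeddings_eq {K : Type*} [Field K] [NumberField K] (ι : K →+* ℂ)
    {D : ℤ} (hD : D < 0) (h4 : D % 4 = 0 ∨ D % 4 = 1) {j : K}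
    (hj : ι j = formJ (principalForm D)) (f : ℂ → ℝ) :
    (classNumber D : ℝ) * ∑ φ : K →+* ℂ, f (φ j) =
      (Module.finrank ℚ K : ℝ) * ∑ Q ∈ reducedForms D, f (formJ Q) := by
  have hx : IsIntegral ℚ j := Algebra.IsSeparable.isIntegral ℚ j
  have hP : principalForm D ∈ reducedForms D := principalForm_mem_reducedForms hD h4
  have hdeg : Module.finrank ℚ ℚ⟮j⟯ = classNumber D := by
    rw [IntermediateField.adjoin.finrank hx]
    have hmin : minpoly ℚ j = minpoly ℚ (formJ (principalForm D)) := by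
      rw [← hj]; exact (minpoly.algHom_eq (ι.toRatAlgHom) ι.injective j).symm
    have := congrArg natDegree (minpoly_formJ_map_eq_classPolynomial hD hP)
    rwa [natDegree_map, natDegree_classPolynomial, ← hmin] at this
  have htower : Module.finrank ℚ ℚ⟮j⟯ * Module.finrank ℚ⟮j⟯ K = Module.finrank ℚ K :=
    Module.finrank_mul_finrank ℚ ℚ⟮j⟯ K
  rw [sum_embeddings_apply_eq j f, aroots_minpoly_eq_of_eq_formJ ι hD h4 hj, Multiset.map_map,
    nsmul_eq_mul, ← mul_assoc, ← htower, hdeg, Nat.cast_mul]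
  congr 1



open NumberField IsDedekindDomain

variable {K : Type*} [Field K] [NumberField K]

/-! ### The radical norm of `1728 + (j − 1728) = j` for `j = g₂³`, `j − 1728 = g₃²` -/

/-- If finitely many distinct primes `v` of `𝓞 K` all contain `y ≠ 0`, then the product of their
norms is at most `|N(y)|` (their product divides `(y)`). [folklore] -/
theorem prod_absNorm_le_natAbs_norm {y : 𝓞 K} (hy : y ≠ 0)
    (T : Finset (HeightOneSpectrum (𝓞 K))) (hT : ∀ v ∈ T, y ∈ v.asIdeal) :
    ∏ v ∈ T, Ideal.absNorm v.asIdeal ≤ (Algebra.norm ℤ y).natAbs := by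
  classical
  have hdvd : (∏ v ∈ T, v.asIdeal) ∣ Ideal.span {y} := by
    refine Finset.prod_dvd_of_coprime ?_ fun v hv => Ideal.dvd_span_singleton.2 (hT v hv)
    intro v _ w _ hvw
    have hne : v.asIdeal ≠ w.asIdeal := fun h => hvw (HeightOneSpectrum.ext h)
    exact Ideal.isCoprime_iff_sup_eq.2 (v.isMaximal.coprime_of_ne w.isMaximal hne)
  have hle : Ideal.span {y} ≤ ∏ v ∈ T, v.asIdeal := Ideal.le_of_dvd hdvd
  have h1 := Ideal.absNorm_dvd_absNorm_of_le hle
  rw [map_prod, Ideal.absNorm_span_singleton] at h1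
  refine Nat.le_of_dvd ?_ h1
  rw [pos_iff_ne_zero, Int.natAbs_ne_zero, Algebra.norm_ne_zero_iff]
  exact hy

/-- **The conductor of `γ₃² − γ₂³ + 1728 = 0`** ([GranvilleStark2000, §2, proof of Theorem 1]:
"`N_K(γ₂³, γ₃², 1728) ≪ N_K(γ₂, 1) N_K(γ₃, 1)`"): for non-zero algebraic integers `g₂, g₃` of `K`,
the radical norm of the point `(1728 : g₃² : g₂³)` is at most `6^{[K:ℚ]} |N(g₂)| |N(g₃)|` — every bad
prime divides `6 g₂ g₃`. [cite: GranvilleStark2000, §2 (proof of Theorem 1)] -/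
theorem radicalNorm_le_of_sq_of_cube {g₂ g₃ : 𝓞 K} (h₂ : g₂ ≠ 0) (h₃ : g₃ ≠ 0) :
    radicalNorm (1728 : K) ((g₃ : K) ^ 2) ((g₂ : K) ^ 3) ≤
      6 ^ Module.finrank ℚ K * (Algebra.norm ℤ g₂).natAbs * (Algebra.norm ℤ g₃).natAbs := by
  classical
  set y : 𝓞 K := 6 * g₂ * g₃ with hydef
  have h6 : (6 : 𝓞 K) ≠ 0 := by exact_mod_cast (by norm_num : (6 : ℤ) ≠ 0)
  have hy : y ≠ 0 := mul_ne_zero (mul_ne_zero h6 h₂) h₃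
  -- the primes containing `y` are finitely many (they divide `(y)`)
  have hS : {v : HeightOneSpectrum (𝓞 K) | y ∈ v.asIdeal}.Finite :=
    (Ideal.finite_factors (I := Ideal.span {y}) (by simpa using hy)).subset fun v hv =>
      Ideal.dvd_span_singleton.2 hv
  -- every bad prime contains `y`
  have hsub : badPrimes (1728 : K) ((g₃ : K) ^ 2) ((g₂ : K) ^ 3) ⊆
      {v : HeightOneSpectrum (𝓞 K) | y ∈ v.asIdeal} := by
    intro v hv
    by_contra hyv
    apply hv
    simp only [Set.mem_setOf_eq] at hyv
    have hprime := v.isPrime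
    have h6v : (6 : 𝓞 K) ∉ v.asIdeal := fun h => hyv (by
      rw [hydef, mul_assoc]; exact Ideal.mul_mem_right _ _ h)
    have h2v : g₂ ∉ v.asIdeal := fun h => hyv (by
      rw [hydef, mul_comm (6 : 𝓞 K), mul_assoc]; exact Ideal.mul_mem_right _ _ h)
    have h3v : g₃ ∉ v.asIdeal := fun h => hyv (Ideal.mul_mem_left _ _ h)
    have h1728 : (1728 : 𝓞 K) ∉ v.asIdeal := by
      have : (1728 : 𝓞 K) = 6 * 6 * 6 * 8 := by norm_num
      intro h
      have h2 : (2 : 𝓞 K) ∉ v.asIdeal := fun h2 => h6v (by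
        have : (6 : 𝓞 K) = 3 * 2 := by norm_num
        rw [this]; exact Ideal.mul_mem_left _ _ h2)
      have h8 : (8 : 𝓞 K) ∉ v.asIdeal := fun h8 => by
        have : (8 : 𝓞 K) = 2 * (2 * 2) := by norm_num
        rw [this] at h8
        rcases hprime.mem_or_mem h8 with h' | h'
        · exact h2 h'
        · rcases hprime.mem_or_mem h' with h'' | h'' <;> exact h2 h''
      rw [this] at h
      rcases hprime.mem_or_mem h with h' | h'
      · rcases hprime.mem_or_mem h' with h'' | h''
        · rcases hprime.mem_or_mem h'' with h''' | h''' <;> exact h6v h'''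
        · exact h6v h''
      · exact h8 h'
    have e1 : v.valuation K (1728 : K) = 1 := by
      have : (1728 : K) = ((1728 : 𝓞 K) : K) := rfl
      rw [this, HeightOneSpectrum.valuation_of_algebraMap, HeightOneSpectrum.intValuation_eq_one_iff]
      exact h1728
    have e2 : v.valuation K ((g₂ : K) ^ 3) = 1 := by
      rw [map_pow, HeightOneSpectrum.valuation_of_algebraMap,
        HeightOneSpectrum.intValuation_eq_one_iff.2 h2v, one_pow]
    have e3 : v.valuation K ((g₃ : K) ^ 2) = 1 := by
      rw [map_pow, HeightOneSpectrum.valuation_of_algebraMap,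
        HeightOneSpectrum.intValuation_eq_one_iff.2 h3v, one_pow]
    exact ⟨e1.trans e3.symm, e3.trans e2.symm⟩
  have hbad : (badPrimes (1728 : K) ((g₃ : K) ^ 2) ((g₂ : K) ^ 3)).Finite := hS.subset hsub
  -- compare the finite products
  rw [radicalNorm, finprod_mem_eq_finite_toFinset_prod _ hbad]
  calc ∏ v ∈ hbad.toFinset, Ideal.absNorm v.asIdeal
      ≤ ∏ v ∈ hS.toFinset, Ideal.absNorm v.asIdeal := by
        apply Finset.prod_le_prod_of_subset_of_one_le'
        · intro v hv
          rw [Set.Finite.mem_toFinset] at hv ⊢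
          exact hsub hv
        · intro v _ _
          rw [Nat.one_le_iff_ne_zero, Ne, Ideal.absNorm_eq_zero_iff]
          exact v.ne_bot
    _ ≤ (Algebra.norm ℤ y).natAbs :=
        prod_absNorm_le_natAbs_norm hy _ fun v hv => by
          rw [Set.Finite.mem_toFinset] at hv; exact hv
    _ = 6 ^ Module.finrank ℚ K * (Algebra.norm ℤ g₂).natAbs * (Algebra.norm ℤ g₃).natAbs := by
        rw [hydef, map_mul, map_mul, Int.natAbs_mul, Int.natAbs_mul]
        congr 2
        have : (6 : 𝓞 K) = algebraMap ℤ (𝓞 K) 6 := by simp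
        rw [this, Algebra.norm_algebraMap, Int.natAbs_pow, RingOfIntegers.rank]
        rfl



omit [NumberField K] in
/-- An infinite place takes the value `n` on the numeral `n`. [folklore] -/
theorem infinitePlace_apply_ofNat (w : InfinitePlace K) (n : ℕ) [n.AtLeastTwo] :
    w (OfNat.ofNat n : K) = (OfNat.ofNat n : ℝ) := by
  rw [← InfinitePlace.norm_embedding_eq, map_ofNat, Complex.norm_ofNat]

/-- `|N(g)| = ∏_w |g|_w^{mult w}` for an algebraic integer `g`, as a real number. [folklore] -/
theorem natAbs_norm_eq_prod_infinitePlace (g : 𝓞 K) :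
    ((Algebra.norm ℤ g).natAbs : ℝ) = ∏ w : InfinitePlace K, w (g : K) ^ w.mult := by
  rw [InfinitePlace.prod_eq_abs_norm, ← Algebra.coe_norm_int, Nat.cast_natAbs]
  push_cast
  rfl

/-- `|N(g₂)|³ ≤ ∏_w max(1, |g₂³|_w)^{mult w}` ("`N(α, 1) ≤ H(α, 1)`",
[GranvilleStark2000, §2, proof of Theorem 1]). [cite: GranvilleStark2000, §2 (proof of Theorem 1)] -/
theorem natAbs_norm_pow_three_le (g₂ : 𝓞 K) :
    ((Algebra.norm ℤ g₂).natAbs : ℝ) ^ 3 ≤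
      ∏ w : InfinitePlace K, max 1 (w ((g₂ : K) ^ 3)) ^ w.mult := by
  have h : ((Algebra.norm ℤ g₂).natAbs : ℝ) ^ 3 = ((Algebra.norm ℤ (g₂ ^ 3)).natAbs : ℝ) := by
    rw [map_pow, Int.natAbs_pow, Nat.cast_pow]
  rw [h, natAbs_norm_eq_prod_infinitePlace]
  push_cast
  refine Finset.prod_le_prod (fun w _ => by positivity) fun w _ => ?_
  exact pow_le_pow_left₀ (apply_nonneg _ _) (le_max_right _ _) _

/-- `|N(g₃)|² ≤ 1729^{[K:ℚ]} ∏_w max(1, |j|_w)^{mult w}` when `g₃² = j − 1728`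
("`H(γ₃(τ)², 1)^{1/2} ≪ H(γ₂³, γ₃², 1728)^{1/2}`"). [cite: GranvilleStark2000, §2 (proof of Theorem 1)] -/
theorem natAbs_norm_sq_le (g₃ : 𝓞 K) {j : K} (hj : (g₃ : K) ^ 2 = j - 1728) :
    ((Algebra.norm ℤ g₃).natAbs : ℝ) ^ 2 ≤
      (1729 : ℝ) ^ Module.finrank ℚ K * ∏ w : InfinitePlace K, max 1 (w j) ^ w.mult := by
  have h : ((Algebra.norm ℤ g₃).natAbs : ℝ) ^ 2 = ((Algebra.norm ℤ (g₃ ^ 2)).natAbs : ℝ) := by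
    rw [map_pow, Int.natAbs_pow, Nat.cast_pow]
  rw [h, natAbs_norm_eq_prod_infinitePlace]
  push_cast
  rw [hj, ← InfinitePlace.sum_mult_eq (K := K), ← Finset.prod_pow_eq_pow_sum, ← Finset.prod_mul_distrib]
  refine Finset.prod_le_prod (fun w _ => by positivity) fun w _ => ?_
  rw [← mul_pow]
  refine pow_le_pow_left₀ (apply_nonneg _ _) ?_ _
  have h1 : w (j - 1728) ≤ w j + w (1728 : K) := by
    rw [sub_eq_add_neg]
    calc w (j + -1728) ≤ w j + w (-1728 : K) := w.val.add_le _ _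
      _ = w j + w (1728 : K) := by rw [show w (-1728 : K) = w (1728 : K) from w.val.map_neg _]
  rw [infinitePlace_apply_ofNat] at h1
  have h2 : w j ≤ max 1 (w j) := le_max_right _ _
  have h3 : (1 : ℝ) ≤ max 1 (w j) := le_max_left _ _
  nlinarith

/-- `∏_w max(1, |j|_w)^{mult w} ≤ 1728^{[K:ℚ]} · H_K(1728 : j − 1728 : j)`: the relative height of
the point `(1728 : j − 1728 : j)` dominates the archimedean size of `j`
("`H(j(τ), 1) ≤ H(j(τ), j(τ) − 1728, 1728)`" up to the normalisation `1728^{[K:ℚ]}`).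
[cite: GranvilleStark2000, §2 eq. (6)] -/
theorem prod_max_pow_le_mulHeight (j : K) :
    ∏ w : InfinitePlace K, max 1 (w j) ^ w.mult ≤
      (1728 : ℝ) ^ Module.finrank ℚ K * Height.mulHeight ![(1728 : K), j - 1728, j] := by
  have h1728 : (1728 : K) ≠ 0 := by norm_num
  set x : Fin 3 → K := ![(1728 : K), j - 1728, j] with hxdef
  set x' : Fin 3 → K := (1728 : K)⁻¹ • x with hx'def
  have hx'0 : x' 0 = 1 := by simp [hx'def, hxdef, h1728]
  have hx'2 : x' 2 = j / 1728 := by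
    simp only [hx'def, hxdef, Pi.smul_apply, smul_eq_mul]
    rw [show (![(1728 : K), j - 1728, j] : Fin 3 → K) 2 = j from rfl]
    ring
  have hx' : x' ≠ 0 := by
    intro h
    have := congrFun h 0
    rw [hx'0] at this
    simp at this
  have hH : Height.mulHeight x = Height.mulHeight x' :=
    (Height.mulHeight_smul_eq_mulHeight x (inv_ne_zero h1728)).symm
  rw [hH, NumberField.mulHeight_eq hx']
  -- the finite part is at least `1`
  have hfin : 1 ≤ ∏ᶠ v : FinitePlace K, ⨆ i, v (x' i) := by
    refine one_le_finprod fun v => Finite.le_ciSup_of_le 0 ?_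
    rw [hx'0, map_one]
  -- the infinite part
  have hinf : ∏ w : InfinitePlace K, (max 1 (w j) / 1728) ^ w.mult ≤
      ∏ w : InfinitePlace K, (⨆ i, w (x' i)) ^ w.mult := by
    refine Finset.prod_le_prod (fun w _ => by positivity) fun w _ => ?_
    refine pow_le_pow_left₀ (div_nonneg (zero_le_one.trans (le_max_left _ _)) (by norm_num)) ?_ _
    have h0 : (1 : ℝ) ≤ ⨆ i, w (x' i) := Finite.le_ciSup_of_le 0 (by rw [hx'0, map_one])
    have h2 : w j / 1728 ≤ ⨆ i, w (x' i) :=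
      Finite.le_ciSup_of_le 2 (by rw [hx'2, map_div₀, infinitePlace_apply_ofNat])
    rcases le_total 1 (w j) with h | h
    · rw [max_eq_right h]; exact h2
    · rw [max_eq_left h]; linarith
  have hprod : ∏ w : InfinitePlace K, (max 1 (w j) / 1728) ^ w.mult =
      (∏ w : InfinitePlace K, max 1 (w j) ^ w.mult) / 1728 ^ Module.finrank ℚ K := by
    simp_rw [div_pow]
    rw [Finset.prod_div_distrib, Finset.prod_pow_eq_pow_sum, InfinitePlace.sum_mult_eq]
  have hpos : (0 : ℝ) < 1728 ^ Module.finrank ℚ K := by positivity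
  have hinf' : ∏ w : InfinitePlace K, max 1 (w j) ^ w.mult ≤
      (1728 : ℝ) ^ Module.finrank ℚ K * ∏ w : InfinitePlace K, (⨆ i, w (x' i)) ^ w.mult := by
    rw [hprod, div_le_iff₀ hpos] at hinf
    linarith
  have hnonneg : 0 ≤ ∏ w : InfinitePlace K, (⨆ i, w (x' i)) ^ w.mult :=
    Finset.prod_nonneg fun w _ => pow_nonneg (Real.iSup_nonneg fun i => apply_nonneg _ _) _
  refine hinf'.trans (mul_le_mul_of_nonneg_left ?_ hpos.le)
  calc ∏ w : InfinitePlace K, (⨆ i, w (x' i)) ^ w.mult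
      = (∏ w : InfinitePlace K, (⨆ i, w (x' i)) ^ w.mult) * 1 := (mul_one _).symm
    _ ≤ (∏ w : InfinitePlace K, (⨆ i, w (x' i)) ^ w.mult) *
          ∏ᶠ v : FinitePlace K, ⨆ i, v (x' i) := mul_le_mul_of_nonneg_left hfin hnonneg


/-! ### Assembly: Theorem 1 of Granville–Stark from uniform abc and the data of Lemma 1 -/

/-- A radical norm is at least `1`. [folklore] -/
theorem one_le_radicalNorm (a b c : K) : 1 ≤ radicalNorm a b c := by
  rw [radicalNorm, finprod_mem_def]
  refine one_le_finprod' fun v => ?_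
  by_cases hv : v ∈ badPrimes a b c
  · rw [Set.mulIndicator_of_mem hv, Nat.one_le_iff_ne_zero, Ne, Ideal.absNorm_eq_zero_iff]
    exact v.ne_bot
  · rw [Set.mulIndicator_of_notMem hv]

/-- The real-variable bookkeeping at the end of the proof of [GranvilleStark2000, Theorem 1]:
from `log H ≤ n log 1728 + n log C + (1+ε)(log Δ + log N)`, the conductor and discriminant
bounds and `n (S − 10 h) ≤ h log H` one gets `S ≤ h (3(1+ε)/(1−5ε) · log d + C₀)`. [folklore] -/
theorem theorem1_arith {ε n h A S LM LdK LN LN₂ LN₃ L1728 LC L36 L6 L1729 Ld : ℝ}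
    (hε : 0 < ε) (hε5 : ε < 1 / 5) (hn : 0 < n) (hh : 0 ≤ h) (hA0 : 0 ≤ A)
    (hA : A = LC + L1728 + (1 + ε) * (L36 / 2 + L6 + L1729 / 2))
    (hlogabc : LM ≤ n * L1728 + n * LC + (1 + ε) * (LdK + LN))
    (hlogdK : LdK ≤ n / 2 * (L36 + Ld)) (hlogN : LN ≤ n * L6 + LN₂ + LN₃)
    (hlogN₂ : LN₂ ≤ LM / 3) (hlogN₃ : LN₃ ≤ (n * L1729 + LM) / 2)
    (hfin : n * (S - 10 * h) ≤ h * LM) :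
    S ≤ h * (3 * (1 + ε) / (1 - 5 * ε) * Ld + (6 * A / (1 - 5 * ε) + 28)) := by
  have hκ : 0 < 1 - 5 * ε := by linarith
  have hε1 : 0 ≤ 1 + ε := by linarith
  have h2 : LdK + LN ≤ n / 2 * (L36 + Ld) + (n * L6 + LM / 3 + (n * L1729 + LM) / 2) := by
    linarith
  have h3 := mul_le_mul_of_nonneg_left h2 hε1
  have hcomb : (1 - 5 * ε) / 6 * LM ≤ n * A + (1 + ε) * (n / 2) * Ld := by
    rw [hA]; linarith
  have hlogM : LM ≤ n * (6 * A / (1 - 5 * ε) + 3 * (1 + ε) / (1 - 5 * ε) * Ld) := by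
    have e : n * (6 * A / (1 - 5 * ε) + 3 * (1 + ε) / (1 - 5 * ε) * Ld) =
        6 * (n * A + (1 + ε) * (n / 2) * Ld) / (1 - 5 * ε) := by
      field_simp
      ring
    rw [e, le_div_iff₀ hκ]
    linarith
  have h4 : n * (S - 10 * h) ≤ n * (h * (6 * A / (1 - 5 * ε) + 3 * (1 + ε) / (1 - 5 * ε) * Ld)) := by
    calc n * (S - 10 * h) ≤ h * LM := hfin
      _ ≤ h * (n * (6 * A / (1 - 5 * ε) + 3 * (1 + ε) / (1 - 5 * ε) * Ld)) :=
          mul_le_mul_of_nonneg_left hlogM hh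
      _ = _ := by ring
  have h5 := le_of_mul_le_mul_left h4 hn
  have hhA : 0 ≤ h * (6 * A / (1 - 5 * ε)) := by positivity
  nlinarith

set_option maxHeartbeats 400000 in
/-- **Granville–Stark, Theorem 1 — the height argument of §2, from the data of Lemma 1.**
Assume the uniform abc conjecture for number fields (`UniformABCConjecture`, the `[K:ℚ]`-th power
of [GranvilleStark2000, eq. (1)]) and let `0 < ε < 1/5`. There is a constant `C₀` such that for
every discriminant `D < 0`, `D ≡ 0, 1 (mod 4)`, every number field `K` with a complex embedding
`ι`, and all algebraic integers `g₂, g₃ ∈ 𝓞 K` with `ι(g₂)³ = j(τ_P)` and `ι(g₃)² = j(τ_P) − 1728`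
(`P` the principal form of discriminant `D`, so `ι(g₂³)` is the singular modulus `j(τ_D)` and
`γ₃² − γ₂³ + 1728 = 0`, [GranvilleStark2000, eq. (5)–(5′)]) whose discriminant satisfies
`|D_K| ≤ (36 |D|)^{[K:ℚ]/2}` (that is `Δ_K ≤ 6√|D|`, the conclusion of
[GranvilleStark2000, Lemma 1] for `K = ℚ(√D)(γ₂(τ), γ₃(τ))`), one has

`π √|D| · ∑_{Q reduced of disc D} 1/a_Q ≤ h(D) · ((3(1+ε)/(1−5ε)) · log|D| + C₀)`,

i.e. `h(D) ≥ (π/3 + o(1)) (√|D|/log|D|) ∑ 1/a` as `ε → 0` [GranvilleStark2000, Theorem 1, eq. (2)].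
Proof (loc. cit., §2): uniform abc in `K` for `1728 + g₃² = g₂³` with the conductor bound
`N_K ≤ 6^{[K:ℚ]} |N g₂| |N g₃| ≤ 6ⁿ H_K(j)^{1/3} (1729ⁿ H_K(j))^{1/2}`
(`radicalNorm_le_of_sq_of_cube`, `natAbs_norm_pow_three_le`, `natAbs_norm_sq_le`), the lower
bound `H_K(1728 : j−1728 : j) ≥ 1728^{−n} ∏_σ max(1, |σ j|)` (`prod_max_pow_le_mulHeight`), the
conjugates of `j` (`classNumber_mul_sum_embeddings_eq`, from the tree's
`minpoly_formJ_map_eq_classPolynomial`) and the `q`-expansion bound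
`log max(1, |j(τ_Q)|) ≥ π√|D|/a_Q − 10` (`pi_mul_sqrt_div_sub_le_log_norm_formJ`). What is NOT
proved here is the existence of such `K, g₂, g₃` with `Δ_K ≤ 6√|D|` — Lemma 1 of the paper
(Weber functions, Shimura reciprocity, conductor–discriminant formula) — nor the integrality of
`j(τ_D)`; they enter as the hypotheses. [cite: GranvilleStark2000, Theorem 1 (proof, §2)] -/
theorem pi_mul_sqrt_mul_sum_inv_le_of_uniformABC (habc : UniformABCConjecture)
    {ε : ℝ} (hε : 0 < ε) (hε5 : ε < 1 / 5) :
    ∃ C₀ : ℝ, ∀ (D : ℤ), D < 0 → (D % 4 = 0 ∨ D % 4 = 1) →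
      ∀ (K : Type) [Field K] [NumberField K] (ι : K →+* ℂ) (g₂ g₃ : 𝓞 K),
        ι (g₂ : K) ^ 3 = formJ (principalForm D) →
        ι (g₃ : K) ^ 2 = formJ (principalForm D) - 1728 →
        |(NumberField.discr K : ℝ)| ≤ (36 * |(D : ℝ)|) ^ ((Module.finrank ℚ K : ℝ) / 2) →
        Real.pi * √(-(D : ℝ)) * ∑ Q ∈ reducedForms D, (1 : ℝ) / Q.1 ≤
          classNumber D * (3 * (1 + ε) / (1 - 5 * ε) * Real.log (-(D : ℝ)) + C₀) := by
  classical
  obtain ⟨C, hC⟩ := habc ε hε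
  -- constants
  set C' : ℝ := max |C| 1 with hC'def
  have hC'1 : 1 ≤ C' := le_max_right _ _
  have hC'0 : 0 < C' := one_pos.trans_le hC'1
  have hκ : 0 < 1 - 5 * ε := by linarith
  set A : ℝ := Real.log C' + Real.log 1728 +
    (1 + ε) * (Real.log 36 / 2 + Real.log 6 + Real.log 1729 / 2) with hAdef
  have hA0 : 0 ≤ A := by
    have h1 : 0 ≤ Real.log C' := Real.log_nonneg hC'1
    have h2 : 0 ≤ Real.log 1728 := Real.log_nonneg (by norm_num)
    have h3 : 0 ≤ Real.log 36 := Real.log_nonneg (by norm_num)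
    have h4 : 0 ≤ Real.log 6 := Real.log_nonneg (by norm_num)
    have h5 : 0 ≤ Real.log 1729 := Real.log_nonneg (by norm_num)
    rw [hAdef]; positivity
  refine ⟨6 * A / (1 - 5 * ε) + 28, ?_⟩
  intro D hD h4 K _ _ ι g₂ g₃ hg₂ hg₃ hdisc
  -- notation and basic facts
  have hD3 : D ≤ -3 := by omega
  set d : ℝ := -(D : ℝ) with hddef
  have hd3 : (3 : ℝ) ≤ d := by
    have : ((D : ℤ) : ℝ) ≤ -3 := by exact_mod_cast hD3
    rw [hddef]; linarith
  have hd0 : 0 < d := by linarith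
  have habsD : |(D : ℝ)| = d := by
    rw [hddef, abs_of_neg (by exact_mod_cast hD)]
  set n : ℕ := Module.finrank ℚ K with hndef
  have hn : 0 < n := Module.finrank_pos
  have hn' : (0 : ℝ) < n := by exact_mod_cast hn
  set h : ℕ := classNumber D with hhdef
  have hh : 0 < h := classNumber_pos hD h4
  have hh' : (0 : ℝ) < h := by exact_mod_cast hh
  have hP : principalForm D ∈ reducedForms D := principalForm_mem_reducedForms hD h4
  have hlogd : 0 ≤ Real.log d := Real.log_nonneg (by linarith)
  have hcoef : 0 ≤ 3 * (1 + ε) / (1 - 5 * ε) := by positivity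
  -- every reduced form has `a ≥ 1` and discriminant `D`
  have hQ : ∀ Q ∈ reducedForms D, discr Q = D ∧ 0 < Q.1 := fun Q hQ =>
    let h := (mem_reducedForms_iff hD).1 hQ
    ⟨h.1, h.2.1⟩
  have hsum_le : ∑ Q ∈ reducedForms D, (1 : ℝ) / Q.1 ≤ h := by
    calc ∑ Q ∈ reducedForms D, (1 : ℝ) / Q.1 ≤ ∑ Q ∈ reducedForms D, (1 : ℝ) := by
          refine Finset.sum_le_sum fun Q hQ' => ?_
          have h1 : (1 : ℝ) ≤ Q.1 := by exact_mod_cast (hQ Q hQ').2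
          rw [div_le_one (by linarith)]
          exact h1
      _ = h := by
          rw [Finset.sum_const, nsmul_eq_mul, mul_one, hhdef]
          rfl
  have hsum0 : 0 ≤ ∑ Q ∈ reducedForms D, (1 : ℝ) / Q.1 :=
    Finset.sum_nonneg fun Q hQ' => by
      have h1 : (0 : ℝ) < Q.1 := by exact_mod_cast (hQ Q hQ').2
      positivity
  -- the right-hand side is at least `28 h`
  have hRHS : (h : ℝ) * 28 ≤ h * (3 * (1 + ε) / (1 - 5 * ε) * Real.log d + (6 * A / (1 - 5 * ε) + 28)) := by
    refine mul_le_mul_of_nonneg_left ?_ hh'.le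
    have : 0 ≤ 6 * A / (1 - 5 * ε) := by positivity
    nlinarith
  by_cases hsmall : d ≤ 32
  · -- small discriminants: the bound is trivial
    have hsqrt : √d ≤ 6 := by
      rw [Real.sqrt_le_left (by norm_num)]
      linarith
    have hpi : Real.pi ≤ 4 := Real.pi_le_four
    calc Real.pi * √d * ∑ Q ∈ reducedForms D, (1 : ℝ) / Q.1 ≤ 4 * 6 * h := by
          have := Real.sqrt_nonneg d
          have := Real.pi_pos.le
          gcongr
      _ ≤ h * 28 := by linarith
      _ ≤ _ := hRHS
  -- large discriminants
  push Not at hsmall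
  set jP : ℂ := formJ (principalForm D) with hjPdef
  -- `j(τ_P)` is large, in particular `≠ 0, 1728`
  have hjP : Real.pi * √d - 10 ≤ Real.log (max 1 ‖jP‖) := by
    have := pi_mul_sqrt_div_sub_le_log_norm_formJ (hQ _ hP).2 (by rw [(hQ _ hP).1]; exact hD)
    rw [(hQ _ hP).1, principalForm_fst, Int.cast_one, div_one] at this
    simpa [hddef] using this
  have hsqrt32 : (5.6 : ℝ) < √d := by
    rw [show (5.6 : ℝ) = √(5.6 ^ 2) by rw [Real.sqrt_sq (by norm_num)]]
    exact Real.sqrt_lt_sqrt (by norm_num) (by nlinarith)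
  have hjP' : (1728 : ℝ) < ‖jP‖ := by
    have hpi3 : (3.14 : ℝ) < Real.pi := Real.pi_gt_d2
    have h1 : (7.5 : ℝ) < Real.log (max 1 ‖jP‖) := by
      have hsq0 : 0 ≤ √d - 5.6 := by linarith
      have hpi0 : 0 ≤ Real.pi - 3.14 := by linarith
      nlinarith [mul_nonneg hpi0 hsq0]
    have h2 : Real.log 1728 < 7.5 := by
      have h15 : Real.log ((1728 : ℝ) ^ 2) < 15 := by
        rw [Real.log_lt_iff_lt_exp (by norm_num)]
        have := Real.exp_one_gt_d9
        have h8 : Real.exp 15 = Real.exp 1 ^ 15 := by rw [← Real.exp_nat_mul]; norm_num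
        rw [h8]
        have : (1728 : ℝ) ^ 2 < (2.7182818283 : ℝ) ^ 15 := by norm_num
        have h27 : (2.7182818283 : ℝ) ^ 15 ≤ Real.exp 1 ^ 15 := by gcongr
        linarith
      rw [Real.log_pow] at h15
      push_cast at h15
      linarith
    have h3 : Real.log 1728 < Real.log (max 1 ‖jP‖) := by linarith
    have h4 : (1728 : ℝ) < max 1 ‖jP‖ := by
      rwa [Real.log_lt_log_iff (by norm_num) (lt_of_lt_of_le one_pos (le_max_left _ _))] at h3
    rcases le_total 1 ‖jP‖ with hle | hle
    · rwa [max_eq_right hle] at h4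
    · rw [max_eq_left hle] at h4; linarith
  have hjP0 : jP ≠ 0 := by
    intro h0; rw [h0, norm_zero] at hjP'; linarith
  have hjP1728 : jP - 1728 ≠ 0 := by
    intro h0
    have : jP = 1728 := sub_eq_zero.1 h0
    rw [this] at hjP'
    norm_num at hjP'
  -- the algebraic data in `K`
  set j : K := (g₂ : K) ^ 3 with hjdef
  have hιj : ι j = jP := by rw [hjdef, map_pow, hg₂]
  have hg₃' : ((g₃ : K)) ^ 2 = j - 1728 := by
    apply ι.injective
    rw [map_pow, hg₃, map_sub, hιj, map_ofNat]
  have hj0 : j ≠ 0 := by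
    intro h0; apply hjP0; rw [← hιj, h0, map_zero]
  have hg₂K : (g₂ : K) ≠ 0 := fun h0 => hj0 (by rw [hjdef, h0]; ring)
  have hg₃K : (g₃ : K) ≠ 0 := by
    intro h0
    apply hjP1728
    rw [← hιj, ← map_ofNat ι 1728, ← map_sub, ← hg₃', h0]
    simp
  have hg₂0 : g₂ ≠ 0 := fun h0 => hg₂K (by rw [h0]; rfl)
  have hg₃0 : g₃ ≠ 0 := fun h0 => hg₃K (by rw [h0]; rfl)
  have hsumK : (1728 : K) + (g₃ : K) ^ 2 = (g₂ : K) ^ 3 := by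
    rw [hg₃', ← hjdef]; ring
  -- uniform abc
  have key := hC K (1728 : K) ((g₃ : K) ^ 2) ((g₂ : K) ^ 3) (by norm_num) (pow_ne_zero _ hg₃K)
    (pow_ne_zero _ hg₂K) hsumK
  have hvec : (![(1728 : K), (g₃ : K) ^ 2, (g₂ : K) ^ 3] : Fin 3 → K) = ![(1728 : K), j - 1728, j] := by
    rw [hg₃']
  rw [hvec] at key
  -- the quantities `M`, `N`, `N₂`, `N₃`, `dK`
  set M : ℝ := ∏ w : InfinitePlace K, max 1 (w j) ^ w.mult with hMdef
  set N : ℝ := (radicalNorm (1728 : K) ((g₃ : K) ^ 2) ((g₂ : K) ^ 3) : ℝ) with hNdef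
  set N₂ : ℝ := ((Algebra.norm ℤ g₂).natAbs : ℝ) with hN₂def
  set N₃ : ℝ := ((Algebra.norm ℤ g₃).natAbs : ℝ) with hN₃def
  set dK : ℝ := |(NumberField.discr K : ℝ)| with hdKdef
  have hM1 : 1 ≤ M := by
    rw [hMdef]
    exact Finset.prod_induction _ (fun x : ℝ => 1 ≤ x)
      (fun a b ha hb => one_le_mul_of_one_le_of_one_le ha hb) le_rfl
      fun w _ => one_le_pow₀ (le_max_left _ _)
  have hM0 : 0 < M := one_pos.trans_le hM1
  have hN1 : 1 ≤ N := by rw [hNdef]; exact_mod_cast one_le_radicalNorm _ _ _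
  have hN0 : 0 < N := one_pos.trans_le hN1
  have hN₂1 : 1 ≤ N₂ := by
    rw [hN₂def, Nat.one_le_cast, Nat.one_le_iff_ne_zero, Ne, Int.natAbs_eq_zero,
      Algebra.norm_eq_zero_iff]
    exact hg₂0
  have hN₃1 : 1 ≤ N₃ := by
    rw [hN₃def, Nat.one_le_cast, Nat.one_le_iff_ne_zero, Ne, Int.natAbs_eq_zero,
      Algebra.norm_eq_zero_iff]
    exact hg₃0
  have hN₂0 : 0 < N₂ := one_pos.trans_le hN₂1
  have hN₃0 : 0 < N₃ := one_pos.trans_le hN₃1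
  have hdK1 : 1 ≤ dK := by
    rw [hdKdef, ← Int.cast_abs, ← Int.cast_one, Int.cast_le]
    exact Int.one_le_abs (NumberField.discr_ne_zero K)
  have hdK0 : 0 < dK := one_pos.trans_le hdK1
  -- the four inequalities
  have hMH : M ≤ (1728 : ℝ) ^ n * Height.mulHeight ![(1728 : K), j - 1728, j] :=
    prod_max_pow_le_mulHeight j
  have hNle : N ≤ (6 : ℝ) ^ n * N₂ * N₃ := by
    rw [hNdef, hN₂def, hN₃def]
    exact_mod_cast radicalNorm_le_of_sq_of_cube hg₂0 hg₃0
  have hN₂le : N₂ ^ 3 ≤ M := natAbs_norm_pow_three_le g₂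
  have hN₃le : N₃ ^ 2 ≤ (1729 : ℝ) ^ n * M := natAbs_norm_sq_le g₃ hg₃'
  -- abc in multiplicative form: `M ≤ 1728ⁿ C'ⁿ (dK N)^{1+ε}`
  have hCn : C ^ n ≤ C' ^ n := by
    calc C ^ n ≤ |C ^ n| := le_abs_self _
      _ = |C| ^ n := abs_pow C n
      _ ≤ C' ^ n := pow_le_pow_left₀ (abs_nonneg C) (le_max_left _ _) n
  have habc' : M ≤ (1728 : ℝ) ^ n * (C' ^ n * (dK * N) ^ (1 + ε)) := by
    have h1 : Height.mulHeight ![(1728 : K), j - 1728, j] ≤ C' ^ n * (dK * N) ^ (1 + ε) := by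
      refine key.le.trans ?_
      have : 0 ≤ (dK * N) ^ (1 + ε) := Real.rpow_nonneg (by positivity) _
      exact mul_le_mul_of_nonneg_right hCn this
    calc M ≤ (1728 : ℝ) ^ n * Height.mulHeight ![(1728 : K), j - 1728, j] := hMH
      _ ≤ _ := mul_le_mul_of_nonneg_left h1 (by positivity)
  -- take logarithms: first the two facts using `hdisc` and `habc'`, which are then cleared
  -- (their real powers make `linarith`'s atom comparison expensive)
  have h36d : (0 : ℝ) < 36 * d := by positivity
  have hlogdK : Real.log dK ≤ n / 2 * (Real.log 36 + Real.log d) := by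
    have h1 : Real.log dK ≤ Real.log ((36 * |(D : ℝ)|) ^ ((n : ℝ) / 2)) :=
      Real.log_le_log hdK0 hdisc
    rw [habsD, Real.log_rpow h36d, Real.log_mul (by norm_num) hd0.ne'] at h1
    linarith only [h1]
  have h1728n : (0 : ℝ) < 1728 ^ n := pow_pos (by norm_num) n
  have hC'n : (0 : ℝ) < C' ^ n := pow_pos hC'0 n
  have hdKN : (0 : ℝ) < dK * N := mul_pos hdK0 hN0
  have hrpow : (0 : ℝ) < (dK * N) ^ (1 + ε) := Real.rpow_pos_of_pos hdKN _
  have hlogabc : Real.log M ≤ n * Real.log 1728 + n * Real.log C' +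
      (1 + ε) * (Real.log dK + Real.log N) := by
    have h1 := Real.log_le_log hM0 habc'
    rw [Real.log_mul h1728n.ne' (mul_pos hC'n hrpow).ne', Real.log_pow,
      Real.log_mul hC'n.ne' hrpow.ne', Real.log_pow,
      Real.log_rpow hdKN, Real.log_mul hdK0.ne' hN0.ne'] at h1
    linarith only [h1]
  clear key habc' hMH hdisc hrpow
  have hlogM0 : 0 ≤ Real.log M := Real.log_nonneg hM1
  have hlogN₂ : Real.log N₂ ≤ Real.log M / 3 := by
    have h1 : Real.log (N₂ ^ 3) ≤ Real.log M := Real.log_le_log (pow_pos hN₂0 3) hN₂le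
    rw [Real.log_pow] at h1
    push_cast at h1
    linarith only [h1]
  have h1729n : (0 : ℝ) < 1729 ^ n := pow_pos (by norm_num) n
  have hlogN₃ : Real.log N₃ ≤ (n * Real.log 1729 + Real.log M) / 2 := by
    have h1 : Real.log (N₃ ^ 2) ≤ Real.log ((1729 : ℝ) ^ n * M) :=
      Real.log_le_log (pow_pos hN₃0 2) hN₃le
    rw [Real.log_pow, Real.log_mul h1729n.ne' hM0.ne', Real.log_pow] at h1
    push_cast at h1
    linarith only [h1]
  have h6n : (0 : ℝ) < 6 ^ n := pow_pos (by norm_num) n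
  have hlogN : Real.log N ≤ n * Real.log 6 + Real.log N₂ + Real.log N₃ := by
    have h1 : Real.log N ≤ Real.log ((6 : ℝ) ^ n * N₂ * N₃) := Real.log_le_log hN0 hNle
    rw [Real.log_mul (mul_pos h6n hN₂0).ne' hN₃0.ne', Real.log_mul h6n.ne' hN₂0.ne',
      Real.log_pow] at h1
    linarith only [h1]
  -- conjugates: `h · log M = n · ∑_Q log max(1, |j(τ_Q)|)`
  have hlogMsum : Real.log M = ∑ φ : K →+* ℂ, Real.log (max 1 ‖φ j‖) := by
    rw [hMdef, prod_infinitePlace_pow_mult_eq_prod_embeddings (fun t => max 1 t) j,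
      Real.log_prod]
    intro φ _
    exact (one_pos.trans_le (le_max_left _ _)).ne'
  have hconj := classNumber_mul_sum_embeddings_eq ι hD h4 hιj (fun z => Real.log (max 1 ‖z‖))
  rw [← hlogMsum] at hconj
  -- the lower bound for the singular moduli
  have hlow : ∑ Q ∈ reducedForms D, (Real.pi * √d / Q.1 - 10) ≤
      ∑ Q ∈ reducedForms D, Real.log (max 1 ‖formJ Q‖) := by
    refine Finset.sum_le_sum fun Q hQ' => ?_
    have h1 := pi_mul_sqrt_div_sub_le_log_norm_formJ (hQ Q hQ').2
      (by rw [(hQ Q hQ').1]; exact hD)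
    rw [(hQ Q hQ').1] at h1
    simpa [hddef] using h1
  have hlow' : ∑ Q ∈ reducedForms D, (Real.pi * √d / Q.1 - 10) =
      Real.pi * √d * ∑ Q ∈ reducedForms D, (1 : ℝ) / Q.1 - 10 * h := by
    rw [Finset.sum_sub_distrib, Finset.mul_sum, Finset.sum_const, nsmul_eq_mul, hhdef]
    have hcard : ((reducedForms D).card : ℝ) =
        (QuadraticFields.BinaryQuadraticForm.classNumber D : ℝ) := rfl
    rw [hcard, mul_comm _ (10 : ℝ)]
    simp only [mul_one_div]
  -- final assembly
  have hfin : (n : ℝ) * (Real.pi * √d * ∑ Q ∈ reducedForms D, (1 : ℝ) / Q.1 - 10 * h) ≤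
      h * Real.log M := by
    calc (n : ℝ) * (Real.pi * √d * ∑ Q ∈ reducedForms D, (1 : ℝ) / Q.1 - 10 * h)
        = n * ∑ Q ∈ reducedForms D, (Real.pi * √d / Q.1 - 10) := by rw [hlow']
      _ ≤ n * ∑ Q ∈ reducedForms D, Real.log (max 1 ‖formJ Q‖) :=
          mul_le_mul_of_nonneg_left hlow hn'.le
      _ = h * Real.log M := hconj.symm
  exact theorem1_arith hε hε5 hn' hh'.le hA0 hAdef hlogabc hlogdK hlogN hlogN₂ hlogN₃ hfin

end HeightArgument


/-! ## The join with `AbcWave0GranvilleStarkProofs`: Theorem 1 — hence Theorem 2 — from the data of Lemma 1 -/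

section Join

open scoped NumberField
open _root_.Literature.NumberTheory.EllipticCurves
  _root_.Literature.NumberTheory.QuadraticFields.BinaryQuadraticForm
  _root_.Literature.NumberTheory.LFunctions.PrimitiveQuadratic

/-- The passage from `π √d S ≤ h (κ log d + C₀)` with `κ ≤ 3 + δ` and `C₀ ≤ δ log d` to
Granville–Stark's `(π/3 − δ)(√d/log d) S ≤ h` (pure real-variable bookkeeping; `3 < π ≤ 4`).
[folklore] -/
theorem thm1_limit_arith {p δ κ C₀ L S h r : ℝ} (hp3 : 3 < p) (hp4 : p ≤ 4) (hδ : 0 < δ)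
    (hκ : κ ≤ 3 + δ) (hC : C₀ ≤ δ * L) (hL : 0 < L) (hS : 0 ≤ S) (hh : 0 ≤ h) (hr : 0 ≤ r)
    (hmain : p * r * S ≤ h * (κ * L + C₀)) :
    (p / 3 - δ) * (r / L) * S ≤ h := by
  rcases le_or_gt (p / 3 - δ) 0 with hneg | hpos
  · have : (p / 3 - δ) * (r / L) * S ≤ 0 :=
      mul_nonpos_of_nonpos_of_nonneg (mul_nonpos_of_nonpos_of_nonneg hneg (by positivity)) hS
    linarith
  · have h1 : p * r * S ≤ h * L * (3 + 2 * δ) := by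
      nlinarith [mul_nonneg (mul_nonneg hh hL.le) (by linarith : (0 : ℝ) ≤ 3 + δ - κ),
        mul_nonneg hh (by linarith : (0 : ℝ) ≤ δ * L - C₀)]
    have hpL : 0 < p * L := by positivity
    have e : (p / 3 - δ) * (r / L) * S = (p / 3 - δ) / (p * L) * (p * r * S) := by
      field_simp
    rw [e]
    calc (p / 3 - δ) / (p * L) * (p * r * S)
        ≤ (p / 3 - δ) / (p * L) * (h * L * (3 + 2 * δ)) :=
          mul_le_mul_of_nonneg_left h1 (div_nonneg hpos.le hpL.le)
      _ = h * ((p / 3 - δ) * (3 + 2 * δ) / p) := by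
          field_simp
      _ ≤ h * 1 := by
          refine mul_le_mul_of_nonneg_left ?_ hh
          rw [div_le_one (by positivity)]
          nlinarith
      _ = h := mul_one h

/-- **Granville–Stark, Theorem 1, from uniform abc and the data of Lemma 1** — in the shape of the
hypothesis `thm1` of `granville_stark_noSiegelZeros_of_thm1_of_eq11`. Assume that for every
modulus `d` carrying an odd real primitive character (equivalently: `−d` is a negative fundamental
discriminant) there are a number field `K` with a complex embedding `ι` and algebraic integers
`g₂, g₃ ∈ 𝓞 K` with `ι(g₂)³ = j(τ_{−d}) = ι(g₃)² + 1728` (the singular modulus of the principal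
form: "an algebraic integer", with `j = γ₂³ = γ₃² + 1728` [GranvilleStark2000, §2 ¶1 and eq. (5)])
and `|D_K| ≤ (36 d)^{[K:ℚ]/2}`, i.e. `Δ_K ≤ 6√d` ("**Lemma 1.** If `K = k(γ₂(τ), γ₃(τ))` … then
`Δ_K ≤ 6√d`" [GranvilleStark2000, Lemma 1]). Then the uniform abc-conjecture implies: for every
`δ > 0` there is `d₀` such that `(π/3 − δ)(√d/log d) ∑_{(a,b,c) reduced} 1/a ≤ h(−d)` for all such
`d ≥ d₀` — "**Theorem 1.** The uniform abc-conjecture for number fields implies that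
`h(−d) ≥ {π/3 + o(1)} (√d/log d) ∑_{(a,b,c) reduced} 1/a`" [GranvilleStark2000, Theorem 1].
Proof: `pi_mul_sqrt_mul_sum_inv_le_of_uniformABC` with `ε = min(δ/36, 1/10)` (so that
`3(1+ε)/(1−5ε) ≤ 3 + δ`) and `d₀ = ⌈exp(C₀/δ)⌉ + 3`. [cite: GranvilleStark2000, Theorem 1 (proof, §2) and Lemma 1] -/
theorem granville_stark_thm1_of_lemma1Data
    (hdata : ∀ (d : ℕ) [NeZero d],
      (∃ χ : DirichletCharacter ℂ d, χ.IsQuadratic ∧ χ.IsPrimitive ∧ χ.Odd) →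
        ∃ (K : Type) (_ : Field K) (_ : NumberField K) (ι : K →+* ℂ) (g₂ g₃ : 𝓞 K),
          ι (g₂ : K) ^ 3 = formJ (principalForm (-(d : ℤ))) ∧
          ι (g₃ : K) ^ 2 = formJ (principalForm (-(d : ℤ))) - 1728 ∧
          |(NumberField.discr K : ℝ)| ≤ (36 * (d : ℝ)) ^ ((Module.finrank ℚ K : ℝ) / 2))
    (habc : UniformABCConjecture) :
    ∀ δ : ℝ, 0 < δ → ∃ d₀ : ℕ, ∀ (d : ℕ) [NeZero d], d₀ ≤ d →
      (∃ χ : DirichletCharacter ℂ d, χ.IsQuadratic ∧ χ.IsPrimitive ∧ χ.Odd) →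
        (Real.pi / 3 - δ) * (Real.sqrt d / Real.log d) *
            ∑ Q ∈ reducedForms (-(d : ℤ)), (1 : ℝ) / (Q.1 : ℝ) ≤ classNumber (-(d : ℤ)) := by
  intro δ hδ
  set ε : ℝ := min (δ / 36) (1 / 10) with hεdef
  have hε : 0 < ε := lt_min (by positivity) (by norm_num)
  have hε10 : ε ≤ 1 / 10 := min_le_right _ _
  have hε36 : ε ≤ δ / 36 := min_le_left _ _
  have hε5 : ε < 1 / 5 := by linarith
  obtain ⟨C₀, hC₀⟩ := pi_mul_sqrt_mul_sum_inv_le_of_uniformABC habc hε hε5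
  have hκ : 3 * (1 + ε) / (1 - 5 * ε) ≤ 3 + δ := by
    rw [div_le_iff₀ (by linarith)]
    nlinarith [mul_le_mul_of_nonneg_right hε10 hδ.le]
  refine ⟨⌈Real.exp (max C₀ 0 / δ)⌉₊ + 3, ?_⟩
  intro d _ hd hχ
  obtain ⟨χ, hquad, hprim, hodd⟩ := hχ
  have hd3 : 3 ≤ d := by omega
  have hd3' : (3 : ℝ) ≤ d := by exact_mod_cast hd3
  have hlogd : 0 < Real.log d := Real.log_pos (by linarith)
  -- `C₀ ≤ δ log d`
  have hC : C₀ ≤ δ * Real.log d := by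
    have h1 : (⌈Real.exp (max C₀ 0 / δ)⌉₊ : ℝ) ≤ d := by
      exact_mod_cast (Nat.le_add_right _ 3).trans hd
    have h2 : Real.exp (max C₀ 0 / δ) ≤ d := (Nat.le_ceil _).trans h1
    have h3 : max C₀ 0 / δ ≤ Real.log d := by
      rw [← Real.log_exp (max C₀ 0 / δ)]
      exact Real.log_le_log (Real.exp_pos _) h2
    rw [div_le_iff₀ hδ] at h3
    linarith [le_max_left C₀ 0]
  -- the data and the inequality of Theorem 1
  have h4 := neg_emod_four_of_odd hprim hquad hodd
  have hD : (-(d : ℤ)) < 0 := by omega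
  obtain ⟨K, _, _, ι, g₂, g₃, hg₂, hg₃, hdisc⟩ := hdata d ⟨χ, hquad, hprim, hodd⟩
  have habs : |(((-(d : ℤ)) : ℤ) : ℝ)| = (d : ℝ) := by
    push_cast
    rw [abs_neg, abs_of_nonneg (Nat.cast_nonneg _)]
  have hmain := hC₀ (-(d : ℤ)) hD h4 K ι g₂ g₃ hg₂ hg₃ (by rw [habs]; exact hdisc)
  have hneg : -(((-(d : ℤ)) : ℤ) : ℝ) = (d : ℝ) := by push_cast; ring
  rw [hneg] at hmain
  have hh : (0 : ℝ) ≤ classNumber (-(d : ℤ)) := Nat.cast_nonneg _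
  have hS : 0 ≤ ∑ Q ∈ reducedForms (-(d : ℤ)), (1 : ℝ) / (Q.1 : ℝ) :=
    Finset.sum_nonneg fun Q hQ => by
      have h1 : (0 : ℝ) < Q.1 := by exact_mod_cast ((mem_reducedForms_iff hD).1 hQ).2.1
      positivity
  exact thm1_limit_arith Real.pi_gt_three Real.pi_le_four hδ hκ hC hlogd hS hh
    (Real.sqrt_nonneg _) hmain

/-- **abc.S22 from the data of Lemma 1 and eq. (11).** `granville_stark_noSiegelZeros`
(`UniformABCConjecture → NoSiegelZerosOddQuadratic`, [GranvilleStark2000, Theorem 2]) follows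
from two displayed statements of the source: (i) `hdata` — for every `d` carrying an odd real
primitive character, a number field `K ∋ γ₂, γ₃` (algebraic integers, `γ₂³ = j(τ_{−d}) = γ₃² + 1728`)
with `|D_K| ≤ (36 d)^{[K:ℚ]/2}` [GranvilleStark2000, Lemma 1 with §2 ¶1 and eq. (5)], and (ii)
`eq11` — the Selberg–Chowla consequence
`|h(−d)(L'/L(1, χ_d) + ½ log d) − (π/6)√d ∑ 1/a| ≤ A₀ ∑ log(√d/a)` [GranvilleStark2000, §3.2 eq. (11)].
The height argument of §2 (this file) turns (i) and uniform abc into Theorem 1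
(`granville_stark_thm1_of_lemma1Data`), and `granville_stark_noSiegelZeros_of_thm1_of_eq11`
(`AbcWave0GranvilleStarkProofs.lean`) turns Theorem 1 and (ii) into Theorem 2. Neither hypothesis
restates the conclusion: (i) is complex multiplication / class field theory (Weber's `γ₂, γ₃`,
Shimura reciprocity, the ray class field mod `6`, the conductor–discriminant formula), (ii) is
Kronecker's limit formula over the form classes with Dirichlet's class number formula; proving
them is what remains of `granville_stark_noSiegelZeros_holds`.
[cite: GranvilleStark2000, Theorem 2 (proof) with Theorem 1, Lemma 1 and eq. (11)] -/
theorem granville_stark_noSiegelZeros_of_lemma1Data_of_eq11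
    (hdata : ∀ (d : ℕ) [NeZero d],
      (∃ χ : DirichletCharacter ℂ d, χ.IsQuadratic ∧ χ.IsPrimitive ∧ χ.Odd) →
        ∃ (K : Type) (_ : Field K) (_ : NumberField K) (ι : K →+* ℂ) (g₂ g₃ : 𝓞 K),
          ι (g₂ : K) ^ 3 = formJ (principalForm (-(d : ℤ))) ∧
          ι (g₃ : K) ^ 2 = formJ (principalForm (-(d : ℤ))) - 1728 ∧
          |(NumberField.discr K : ℝ)| ≤ (36 * (d : ℝ)) ^ ((Module.finrank ℚ K : ℝ) / 2))
    (eq11 : ∃ A₀ : ℝ, ∃ d₀ : ℕ, ∀ (d : ℕ) [NeZero d], d₀ ≤ d → ∀ χ : DirichletCharacter ℂ d,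
      χ.IsQuadratic → χ.IsPrimitive → χ.Odd →
        |(classNumber (-(d : ℤ)) : ℝ) * ((deriv χ.LFunction 1 / χ.LFunction 1).re + Real.log d / 2) -
            Real.pi / 6 * Real.sqrt d * ∑ Q ∈ reducedForms (-(d : ℤ)), (1 : ℝ) / (Q.1 : ℝ)| ≤
          A₀ * ∑ Q ∈ reducedForms (-(d : ℤ)), Real.log (Real.sqrt d / (Q.1 : ℝ))) :
    granville_stark_noSiegelZeros :=
  granville_stark_noSiegelZeros_of_thm1_of_eq11
    (fun habc => granville_stark_thm1_of_lemma1Data hdata habc) eq11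

end Join

end Literature.NumberTheory.DiophantineGeometry

end
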